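import Summits.ResolutionOfSingularities.KangarooAtlas.MizutaniExpandDimension
import Summits.ResolutionOfSingularities.KangarooAtlas.MizutaniNumber
import Summits.ResolutionOfSingularities.KangarooAtlas.MizutaniMultiplicityBridge
import Mathlib.RingTheory.KrullDimension.NonZeroDivisors
import HarnessLib

/-!
# Mizutani's conjecture — the DIMENSION of the scheme cut out by the invariant additive forms is Oda's formula

Cell topic `Summits/ResolutionOfSingularities/KangarooAtlas` (pub-rosobs); namespace
`Summit.ResolutionOfSingularities.KangarooAtlas.Mizutani`.  Part of the Lean transcription of the in-house note
MIZUTANI-PROOF-g59 (AI-written, AI-audited; *AI review is weaker than expert review*; NOT a resolution theorem, NOT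
summit progress).  The vocabulary file `Literature/…/HironakaGroupScheme.lean` takes Oda's sentence "the dimension
of `B(𝔭)` equals the rank of `L/L_B` as a module over `k[F]`" (Publ. RIMS 19 (1983) p. 1168; Mizutani 1973
Thm. 1.3: `dim Spec(S/N S) = dim_k (L_e/N_e)`) as the DEFINITION `hsDimAt k p 𝔭 e₀ := (n+1) − dim_k (L_B)_{e₀}`.
This file turns that sentence into a THEOREM about the closed subscheme of `Spec S = 𝔸^{n+1}` cut out by the
invariant additive forms:

* for any levelwise family `N : ℕ → (subspaces of k^{n+1})` — `levelIdeal N e = (Σ a_j X_j^{p^e} : a ∈ N e)`,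
  `famIdeal N = (Σ a_j X_j^{p^e} : e ≥ 0, a ∈ N e)`;
  `ringKrullDim_quotient_levelIdeal : dim S ⧸ levelIdeal N e = (n+1) − dim_k (N e)` (the general
  `ringKrullDim_quotient_span_powForm` of `MizutaniExpandDimension.lean`);
* for an `F`-STABLE family (`F^m (N e) ⊆ N (e+m)`) which is generated in degrees `≤ e₀`
  (`N j = k·F^{j−e₀}(N e₀)` for `j ≥ e₀`): `famIdeal N` and `levelIdeal N e₀` have the same radical
  (`radical_famIdeal_eq`), hence **`ringKrullDim_quotient_famIdeal : dim S ⧸ famIdeal N = (n+1) − dim_k (N e₀)`**;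
  every `F`-stable family is generated in some finite degree (`exists_eventually_eq_span`);
* **`schemeIdeal k p 𝔭 := famIdeal (invForms k p 𝔭)`** — the ideal generated by ALL of Oda's invariant additive
  forms of `𝔭` (all levels), i.e. the ideal of the subgroup scheme `B(𝔭) ⊂ 𝔸^{n+1}` in Oda's description — and
  **`ringKrullDim_quotient_schemeIdeal : ringKrullDim (S ⧸ schemeIdeal k p 𝔭) = hsDim k p 𝔭`**: Oda's rank
  formula (read at the exponent, `MizutaniNumber.lean`) IS the Krull dimension of that scheme;
  `ringKrullDim_quotient_schemeIdeal_eq_hsDimAt` (any level `e₀ ≥ exponent`);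
* the same for Hironaka's side `U(𝔭) ∩ L` (`hirForms`, encloser-1's `MizutaniMultiplicity.lean`):
  `ringKrullDim_quotient_famIdeal_hirForms`.  (That `famIdeal (hirForms k p 𝔭)` is Hironaka's ideal `U_+(𝔭)S`
  — the tree's `HironakaScheme.bIdeal` — is Hironaka's theorem "U is generated by additive forms", the named
  fact `Hironaka1970_thm1_cor`, not used or proved here.)

References: [Oda1983HironakaGroupSchemeII] §2 (p. 1168); [Mizutani1973HironakaGroupSchemes] §1 (Def. 1.1, (c)),
Thm. 1.3; [Matsumura1987] Thm. 5.6, Thm. 9.4.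
-/

open MvPolynomial Literature.AlgebraicGeometry.Resolution Literature.AlgebraicGeometry.Resolution.HironakaScheme
  Literature.RingTheory.MvPolynomial

namespace Summit.ResolutionOfSingularities.KangarooAtlas.Mizutani

universe u

section Family

variable (k : Type u) [Field k] (p : ℕ) [hp : Fact p.Prime] [CharP k p] {n : ℕ}

omit hp [CharP k p] in
/-- `addForm k p e` is the `p^e`-power form `powForm (p^e)`. [folklore] -/
theorem addForm_eq_powForm (e : ℕ) (a : Fin (n + 1) → k) : addForm k p e a = powForm (p ^ e) a := rfl

/-- `(Σ_j a_j X_j^{p^e})^{p^m} = Σ_j a_j^{p^m} X_j^{p^{e+m}}`: `addForm e a ^ p^m = addForm (e+m) (F^m a)`.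
[cite: Oda1983HironakaGroupSchemeII, §2 (p. 1168: L is a graded left k[F]-module)] -/
theorem addForm_pow_pow (e m : ℕ) (a : Fin (n + 1) → k) :
    addForm k p e a ^ p ^ m = addForm k p (e + m) (frobVec k p m a) := by
  unfold addForm frobVec
  rw [sum_pow_char_pow]
  refine Finset.sum_congr rfl fun j _ => ?_
  rw [mul_pow, ← C_pow, ← pow_mul, ← pow_add]

/-- `addForm k p e` as a `k`-linear map `k^{n+1} → S` (`= expand (p^e) ∘ linForm`). [folklore] -/
noncomputable def addFormLin (e : ℕ) : (Fin (n + 1) → k) →ₗ[k] MvPolynomial (Fin (n + 1)) k :=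
  (expand (p ^ e) : MvPolynomial (Fin (n + 1)) k →ₐ[k] MvPolynomial (Fin (n + 1)) k).toLinearMap ∘ₗ linForm

omit hp [CharP k p] in
/-- `addFormLin e a = addForm e a`. [folklore] -/
theorem addFormLin_apply (e : ℕ) (a : Fin (n + 1) → k) : addFormLin k p e a = addForm k p e a := by
  rw [addFormLin, LinearMap.comp_apply, AlgHom.toLinearMap_apply, expand_linForm, addForm_eq_powForm]

variable (N : ℕ → Submodule k (Fin (n + 1) → k))

/-- The ideal generated by the additive forms of ONE level `e` of a levelwise family `N`:
`(Σ_j a_j X_j^{p^e} : a ∈ N e)`. [cite: Mizutani1973HironakaGroupSchemes, Thm. 1.3 (the ideal N_e S)] -/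
noncomputable def levelIdeal (e : ℕ) : Ideal (MvPolynomial (Fin (n + 1)) k) :=
  Ideal.span (addForm k p e '' (N e : Set (Fin (n + 1) → k)))

/-- The ideal generated by the additive forms of ALL levels of a levelwise family `N`:
`(Σ_j a_j X_j^{p^e} : e ≥ 0, a ∈ N e)`. [cite: Mizutani1973HironakaGroupSchemes, Def. 1.1 and Thm. 1.3 (Spec(S/N S))] -/
noncomputable def famIdeal : Ideal (MvPolynomial (Fin (n + 1)) k) :=
  Ideal.span (⋃ e, addForm k p e '' (N e : Set (Fin (n + 1) → k)))

omit [CharP k p] in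
/-- **`dim S ⧸ (Σ a_j X_j^{p^e} : a ∈ N e) = (n+1) − dim_k (N e)`.** [cite: Mizutani1973HironakaGroupSchemes, Thm. 1.3 ("dim(Spec(S/N S)) = dim_k(L_e/N_e)")] -/
theorem ringKrullDim_quotient_levelIdeal (e : ℕ) :
    ringKrullDim (MvPolynomial (Fin (n + 1)) k ⧸ levelIdeal k p N e) =
      ((n + 1 - Module.finrank k (N e) : ℕ) : WithBot ℕ∞) := by
  unfold levelIdeal
  have h : addForm k p e = powForm (k := k) (m := n + 1) (p ^ e) := by
    funext a; rfl
  rw [h]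
  exact ringKrullDim_quotient_span_powForm (p ^ e) (pow_ne_zero e hp.out.ne_zero) (N e)

omit hp [CharP k p] in
/-- `levelIdeal N e ≤ famIdeal N`. [folklore] -/
theorem levelIdeal_le_famIdeal (e : ℕ) : levelIdeal k p N e ≤ famIdeal k p N := by
  unfold levelIdeal famIdeal
  exact Ideal.span_mono (Set.subset_iUnion (fun e => addForm k p e '' (N e : Set (Fin (n + 1) → k))) e)

variable {N}

/-- For an `F`-stable family generated in degrees `≤ e₀`, **every additive form of the family has a power in the
level-`e₀` ideal**: `famIdeal N ≤ radical (levelIdeal N e₀)` (levels `j ≤ e₀`: raise to the `p^{e₀−j}`-th power;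
levels `j ≥ e₀`: `N j = k·F^{j−e₀}(N e₀)` and `addForm j (F^{j−e₀} b) = (addForm e₀ b)^{p^{j−e₀}}`).
[cite: Mizutani1973HironakaGroupSchemes, §1 (a)–(c) (exponent of a graded k[F]-module)] -/
theorem famIdeal_le_radical_levelIdeal (hF : ∀ e m, ∀ a ∈ N e, frobVec k p m a ∈ N (e + m)) {e₀ : ℕ}
    (hE : ∀ j, e₀ ≤ j → N j ≤ Submodule.span k (frobVec k p (j - e₀) '' (N e₀ : Set (Fin (n + 1) → k)))) :
    famIdeal k p N ≤ (levelIdeal k p N e₀).radical := by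
  unfold famIdeal
  rw [Ideal.span_le]
  rintro _ ⟨_, ⟨j, rfl⟩, ⟨a, ha, rfl⟩⟩
  rw [SetLike.mem_coe]
  rcases le_or_gt j e₀ with hj | hj
  · -- `(addForm j a)^{p^{e₀−j}} = addForm e₀ (F^{e₀−j} a) ∈ levelIdeal e₀`
    obtain ⟨m, rfl⟩ := Nat.exists_eq_add_of_le hj
    refine Ideal.mem_radical_iff.mpr ⟨p ^ m, ?_⟩
    rw [addForm_pow_pow]
    exact Ideal.subset_span ⟨frobVec k p m a, hF j m a ha, rfl⟩
  · -- `addForm j a ∈ levelIdeal e₀` itself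
    refine Ideal.le_radical ?_
    obtain ⟨m, rfl⟩ := Nat.exists_eq_add_of_le hj.le
    have ha' : a ∈ Submodule.span k (frobVec k p m '' (N e₀ : Set (Fin (n + 1) → k))) := by
      have := hE (e₀ + m) (Nat.le_add_right _ _) ha
      rwa [Nat.add_sub_cancel_left] at this
    -- the ideal generated by the additive forms of a span is generated by those of a spanning set
    have hmem : addForm k p (e₀ + m) a ∈
        Ideal.span (addFormLin k p (e₀ + m) '' (frobVec k p m '' (N e₀ : Set (Fin (n + 1) → k)))) := by
      rw [← ideal_span_image_span, ← addFormLin_apply]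
      exact Ideal.subset_span ⟨a, ha', rfl⟩
    refine (Ideal.span_le.mpr ?_) hmem
    rintro _ ⟨_, ⟨b, hb, rfl⟩, rfl⟩
    show addFormLin k p (e₀ + m) (frobVec k p m b) ∈ levelIdeal k p N e₀
    rw [addFormLin_apply, ← addForm_pow_pow]
    have hb' : addForm k p e₀ b ∈ levelIdeal k p N e₀ := Ideal.subset_span ⟨b, hb, rfl⟩
    exact Ideal.pow_mem_of_mem _ hb' _ (pow_pos hp.out.pos _)

/-- For an `F`-stable family generated in degrees `≤ e₀`: **`famIdeal N` and `levelIdeal N e₀` have the same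
radical** (the same underlying closed subset of `𝔸^{n+1}`). [cite: Mizutani1973HironakaGroupSchemes, §1 (c), Thm. 1.3] -/
theorem radical_famIdeal_eq (hF : ∀ e m, ∀ a ∈ N e, frobVec k p m a ∈ N (e + m)) {e₀ : ℕ}
    (hE : ∀ j, e₀ ≤ j → N j ≤ Submodule.span k (frobVec k p (j - e₀) '' (N e₀ : Set (Fin (n + 1) → k)))) :
    (famIdeal k p N).radical = (levelIdeal k p N e₀).radical :=
  le_antisymm (Ideal.radical_le_radical_iff.mpr (famIdeal_le_radical_levelIdeal k p hF hE))
    (Ideal.radical_mono (levelIdeal_le_famIdeal k p N e₀))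

/-- Quotients by ideals with the same radical have the same Krull dimension. [folklore] -/
theorem ringKrullDim_quotient_eq_of_radical_eq {R : Type*} [CommRing R] {I J : Ideal R}
    (h : I.radical = J.radical) : ringKrullDim (R ⧸ I) = ringKrullDim (R ⧸ J) := by
  rw [ringKrullDim_quotient, ringKrullDim_quotient, ← PrimeSpectrum.zeroLocus_radical I,
    ← PrimeSpectrum.zeroLocus_radical J, h]

/-- **`dim S ⧸ famIdeal N = (n+1) − dim_k (N e₀)`** for an `F`-stable family generated in degrees `≤ e₀`.
[cite: Mizutani1973HironakaGroupSchemes, Thm. 1.3 ("dim(Spec(S/N S)) = dim_k(L_e/N_e)")] -/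
theorem ringKrullDim_quotient_famIdeal (hF : ∀ e m, ∀ a ∈ N e, frobVec k p m a ∈ N (e + m)) {e₀ : ℕ}
    (hE : ∀ j, e₀ ≤ j → N j ≤ Submodule.span k (frobVec k p (j - e₀) '' (N e₀ : Set (Fin (n + 1) → k)))) :
    ringKrullDim (MvPolynomial (Fin (n + 1)) k ⧸ famIdeal k p N) =
      ((n + 1 - Module.finrank k (N e₀) : ℕ) : WithBot ℕ∞) := by
  rw [ringKrullDim_quotient_eq_of_radical_eq (radical_famIdeal_eq k p hF hE), ringKrullDim_quotient_levelIdeal]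

/-- **Every `F`-stable levelwise family is generated in some finite degree**: there is `e₀` with
`N j = k·F^{j−e₀}(N e₀)` for all `j ≥ e₀` (the dimensions `dim_k (N j) ≤ n+1` are non-decreasing; take a level of
maximal dimension). [cite: Oda1983HironakaGroupSchemeII, §2 (p. 1168: L is a finitely generated graded k[F]-module)] -/
theorem exists_eventually_eq_span (hF : ∀ e m, ∀ a ∈ N e, frobVec k p m a ∈ N (e + m)) :
    ∃ e₀, ∀ j, e₀ ≤ j → N j = Submodule.span k (frobVec k p (j - e₀) '' (N e₀ : Set (Fin (n + 1) → k))) := by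
  classical
  set d : ℕ → ℕ := fun j => Module.finrank k (N j) with hd
  have hle : ∀ j, d j ≤ n + 1 := fun j => by
    have h := Submodule.finrank_le (N j)
    rw [Module.finrank_pi, Fintype.card_fin] at h
    exact h
  have hspec : ∃ j, d j = Nat.findGreatest (fun v => ∃ j, d j = v) (n + 1) :=
    Nat.findGreatest_spec (P := fun v => ∃ j, d j = v) (hle 0) ⟨0, rfl⟩
  obtain ⟨e₀, he₀⟩ := hspec
  have hmax : ∀ j, d j ≤ d e₀ := fun j => by
    rw [he₀]
    exact Nat.le_findGreatest (P := fun v => ∃ j, d j = v) (hle j) ⟨j, rfl⟩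
  refine ⟨e₀, fun j hj => ?_⟩
  obtain ⟨m, rfl⟩ := Nat.exists_eq_add_of_le hj
  rw [Nat.add_sub_cancel_left]
  have hsub : Submodule.span k (frobVec k p m '' (N e₀ : Set (Fin (n + 1) → k))) ≤ N (e₀ + m) := by
    rw [Submodule.span_le]
    rintro _ ⟨a, ha, rfl⟩
    exact hF e₀ m a ha
  symm
  haveI : FiniteDimensional k (N (e₀ + m)) := FiniteDimensional.finiteDimensional_submodule _
  refine Submodule.eq_of_le_of_finrank_le hsub ?_
  rw [finrank_span_frobVec_image]
  exact hmax (e₀ + m)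

end Family

/-! ## The scheme cut out by Oda's invariant forms has dimension `hsDim` -/

section Scheme

variable (k : Type u) [Field k] (p : ℕ) [hp : Fact p.Prime] [CharP k p] {n : ℕ}
  (𝔭 : Ideal (MvPolynomial (Fin (n + 1)) k))

/-- **The ideal of the Hironaka scheme `B(𝔭) ⊂ Spec S = 𝔸^{n+1}` in Oda's description**: generated by ALL the
invariant additive forms `Σ_j a_j X_j^{p^e}`, `a ∈ (L_B)_e = invForms k p 𝔭 e`, `e ≥ 0`.
[cite: Oda1983HironakaGroupSchemeII, §2 (p. 1168: B ↔ L_B); Mizutani1973HironakaGroupSchemes, Def. 1.1] -/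
noncomputable def schemeIdeal : Ideal (MvPolynomial (Fin (n + 1)) k) := famIdeal k p (invForms k p 𝔭)

/-- `schemeIdeal` unfolded. [folklore] -/
theorem schemeIdeal_eq : schemeIdeal k p 𝔭 =
    Ideal.span (⋃ e, addForm k p e '' (invForms k p 𝔭 e : Set (Fin (n + 1) → k))) := rfl

/-- **`dim (S ⧸ schemeIdeal) = hsDimAt 𝔭 e₀` at every level `e₀ ≥ exponent`** — Oda's formula
`(n+1) − dim_k (L_B)_{e₀}` is the Krull dimension of the subscheme of `𝔸^{n+1}` cut out by the invariant additive
forms. [cite: Oda1983HironakaGroupSchemeII, §2 (p. 1168: "The dimension of B(𝔭) equals the rank of L/L_B as a module over k[F]"); Mizutani1973HironakaGroupSchemes, Thm. 1.3] -/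
theorem ringKrullDim_quotient_schemeIdeal_eq_hsDimAt {e₀ : ℕ} (hE : ExponentLE k p 𝔭 e₀) :
    ringKrullDim (MvPolynomial (Fin (n + 1)) k ⧸ schemeIdeal k p 𝔭) = (hsDimAt k p 𝔭 e₀ : WithBot ℕ∞) := by
  have h := ringKrullDim_quotient_famIdeal k p (N := invForms k p 𝔭) (e₀ := e₀)
    (fun e m a ha => frobVec_mem_invForms k p 𝔭 ha m) (fun j hj => (hE j hj).le)
  unfold schemeIdeal hsDimAt
  exact h

/-- **THE DIMENSION OF `B(𝔭)` IS ODA'S FORMULA**: `ringKrullDim (S ⧸ schemeIdeal k p 𝔭) = hsDim k p 𝔭` for every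
ideal `𝔭` — the sentence of Oda 1983-II p. 1168 / Mizutani 1973 Thm. 1.3 that `HironakaGroupScheme.lean` takes as the
definition `hsDimAt`, proved for the closed subscheme of `𝔸^{n+1}` cut out by the invariant additive forms.
[cite: Oda1983HironakaGroupSchemeII, §2 (p. 1168); Mizutani1973HironakaGroupSchemes, Thm. 1.3] -/
theorem ringKrullDim_quotient_schemeIdeal :
    ringKrullDim (MvPolynomial (Fin (n + 1)) k ⧸ schemeIdeal k p 𝔭) = (hsDim k p 𝔭 : WithBot ℕ∞) := by
  rw [ringKrullDim_quotient_schemeIdeal_eq_hsDimAt k p 𝔭 (exponentLE_exponent k p 𝔭)]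
  rfl

/-- **Mizutani's lower bound as a statement about schemes**: for every point `𝔭` of `ℙ^n_k`, the subscheme of
`𝔸^{n+1}` cut out by the invariant additive forms of `𝔭` has Krull dimension `≥ 2·p^{exponent} − 1`.
[cite: Mizutani1973HironakaGroupSchemes, Remark 2.10] -/
theorem two_mul_pow_exponent_le_ringKrullDim_succ (hP : IsPoint k 𝔭) :
    (2 * p ^ exponent k p 𝔭 : WithBot ℕ∞) ≤
      ringKrullDim (MvPolynomial (Fin (n + 1)) k ⧸ schemeIdeal k p 𝔭) + 1 := by
  rw [ringKrullDim_quotient_schemeIdeal]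
  have h := two_mul_pow_exponent_le k p 𝔭 hP
  have : ((2 * p ^ exponent k p 𝔭 : ℕ) : WithBot ℕ∞) ≤ ((hsDim k p 𝔭 + 1 : ℕ) : WithBot ℕ∞) := by
    exact_mod_cast h
  simpa using this

/-- The same for Hironaka's `U(𝔭) ∩ L` (`hirForms`, the multiplicity side): the subscheme cut out by the additive
forms of `U(𝔭)` has Krull dimension `(n+1) − dim_k (U(𝔭) ∩ L)_{e₀}` for every level `e₀` from which on
`U(𝔭) ∩ L` is generated (such a level exists, `exists_eventually_eq_span` with `frobVec_mem_hirForms`).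
[cite: Mizutani1973HironakaGroupSchemes, Def. 1.1, §1 (c), Thm. 1.3] -/
theorem ringKrullDim_quotient_famIdeal_hirForms [𝔭.IsPrime] {e₀ : ℕ}
    (hE : ∀ j, e₀ ≤ j → hirForms k p 𝔭 j ≤
      Submodule.span k (frobVec k p (j - e₀) '' (hirForms k p 𝔭 e₀ : Set (Fin (n + 1) → k)))) :
    ringKrullDim (MvPolynomial (Fin (n + 1)) k ⧸ famIdeal k p (hirForms k p 𝔭)) =
      ((n + 1 - Module.finrank k (hirForms k p 𝔭 e₀) : ℕ) : WithBot ℕ∞) :=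
  ringKrullDim_quotient_famIdeal k p (fun _ m _ ha => frobVec_mem_hirForms m ha) hE

/-- `U(𝔭) ∩ L` is generated in some finite degree. [cite: Mizutani1973HironakaGroupSchemes, §1 (c) (the exponent e(U(𝔭) ∩ L))] -/
theorem exists_eventually_eq_span_hirForms [𝔭.IsPrime] :
    ∃ e₀, ∀ j, e₀ ≤ j → hirForms k p 𝔭 j =
      Submodule.span k (frobVec k p (j - e₀) '' (hirForms k p 𝔭 e₀ : Set (Fin (n + 1) → k))) :=
  exists_eventually_eq_span k p fun _ m _ ha => frobVec_mem_hirForms m ha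

end Scheme

end Summit.ResolutionOfSingularities.KangarooAtlas.Mizutani
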